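import Mathlib.CategoryTheory.Adjunction.FullyFaithful
import Mathlib.CategoryTheory.Sites.LocallyBijective
import Literature.AlgebraicGeometry.Motives.EtaleToProetExt
import HarnessLib

/-!
# Bhatt–Scholze Lemma 5.1.2 from Lemma 5.1.1: `ν*` is faithful (proved), and fully faithful
# given the sections formula `ν*F(lim U_i) = colim F(U_i)`

`EtaleToProetExt.lean` reduced the pro-étale/étale comparison (Bhatt–Scholze Cor. 5.1.6, and
with it `finite_proetCohomology_zmod_of_isProper`) to two named facts, one of which is
`full_faithful_etaleToProetPullback` — "the pullback `ν* : Shv(X_ét) → Shv(X_proét)` is fully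
faithful" (Lemma 5.1.2). Bhatt–Scholze prove Lemma 5.1.2 from Lemma 5.1.1 ("for `F ∈ Shv(X_ét)` and
`U ∈ X_proét^aff` with a presentation `U = lim_i U_i`, one has `ν*F(U) = colim_i F(U_i)`"):
"Lemma 5.1.1 shows that `F ≃ ν_*ν*F` for any `F ∈ Shv(X_ét)`, which formally implies that `ν*` is
fully faithful." This file carries out that step on Mathlib's carriers and proves half of
Lemma 5.1.2 outright:

* **`ν*` is faithful — proved unconditionally** (`faithful_etaleToProetPullback`): for every
  abelian étale sheaf `F` and every `U ∈ X_ét` the unit `η_F(U) : F(U) → ν*F(U)` is injective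
  (`injective_etaleToProetAdjunction_unit_app`). Proof: `ν*F` is the sheafification of the left
  Kan extension `P = Lan F` along `X_ét ⊂ X_proét`, whose value at `W ∈ X_proét` is the filtered
  colimit `colim_{W → V, V ∈ X_ét} F(V)`; if `s ∈ F(U)` dies in `ν*F(U)` it dies in `P` on a
  pro-étale covering sieve of `U` (sheafification is locally injective), i.e. for each `f : W → U`
  in the sieve `s` dies in `F(V_f)` for some étale `V_f → U` through which `f` factors; pro-étale
  covering sieves are jointly surjective (fpqc covers, Def. 4.1.1), so the `V_f → U` are a jointly
  surjective family of étale maps, i.e. an étale covering, on which `s` vanishes; hence `s = 0`.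
* **Bhatt–Scholze Def. 4.2.1** (`ProetAffinePresentation`): a presentation `W = lim_i U_i` of
  `W ∈ X_proét` as a small cofiltered limit of affine schemes `U_i ∈ X_ét`, and the canonical
  cocone `F(U_i) → ν*F(W)` (`ProetAffinePresentation.sectionsCocone`).
* **Bhatt–Scholze Lemma 5.1.1 as a named fact** (statement only, D-0014):
  `nonempty_isColimit_sectionsCocone_etaleToProetPullback` — the canonical cocone exhibits
  `ν*F(W)` as `colim_i F(U_i)`.
* **Lemma 5.1.2 from Lemma 5.1.1, proved**: the sections formula for the trivial presentation of an
  affine `U ∈ X_ét` makes `η_F(U)` bijective at affine `U`, hence (affine opens cover, both sides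
  are étale sheaves) `η_F` is an isomorphism `F ≃ ν_*ν*F`
  (`isIso_etaleToProetAdjunction_unit_app_of_sections`) and `ν*` is full
  (`full_faithful_etaleToProetPullback_of_sections`).

Consequently the trust base of `finite_proetCohomology_zmod_of_isProper` becomes
{`finite_etaleCohomology_of_isProper` (Milne VI 2.8), Lemma 5.1.1
(`nonempty_isColimit_sectionsCocone_etaleToProetPullback`), acyclicity of `ν*I` for injective `I`
(the residual proof obligation of Cor. 5.1.6, an explicit hypothesis spelled out verbatim — it was
the named fact `subsingleton_sheafH_etaleToProetPullback_injective` of `EtaleToProetExt.lean`,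
merged back into Cor. 5.1.6 under D-0026)}
(`finite_proetCohomology_zmod_of_isProper_of_sections`).

## References

* B. Bhatt, P. Scholze, *The pro-étale topology for schemes*, Astérisque 369 (2015)
  (arXiv:1309.1198, held; arXiv pages): Def. 4.1.1 (p. 23: covers of `X_proét` are fpqc covers),
  Lemma 4.1.8 (p. 23: limits of affine weakly étale `X`-schemes agree with those in `Sch/X`),
  Def. 4.2.1 (p. 24: pro-étale affines and presentations), Lemma 5.1.1 and Lemma 5.1.2 (p. 29).
  [BhattScholze2015]

## Design notes

* The hard computations are done with Mathlib's *constructed* pullback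
  `sheafPullbackConstruction.sheafPullback = sheafify ∘ Lan` and its adjunction
  (`etaleToProetPullback'`, `etaleToProetAdjunction'`), whose unit is `lanUnit ≫ toSheafify`
  (`etaleToProetAdjunction'_unit_app_hom`); results are transported to the abstract left adjoint
  `etaleToProetPullback X = Functor.sheafPullback` of `EtaleToProet.lean` along
  `sheafPullbackIso` (`etaleToProetAdjunction_unit_app`). Instances are declared only on this
  cluster's own functors.
* Lemma 5.1.1 is stated for `Ab.{u+1}`-valued sheaves (the coefficients of `etaleToProetPullback`)
  and for presentations whose cone is a limit cone of `X`-schemes (in `Over X`; Lemma 4.1.8: limits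
  of affine weakly étale `X`-schemes "agree with those in `Sch/X`"; such a cone is then also a limit
  in `X.ProEt`, `ProetAffinePresentation.isLimitProEt`); the printed statement is for sheaves of
  sets on the cut-off site (Remark 4.1.2), from which the abelian case follows. Only
  `Nonempty (IsColimit _)` of the canonical cocone is recorded. Its printed proof needs the
  ind-étale structure of affine weakly étale maps (Thm. 2.3.4, Lemma 4.2.4; not in Mathlib) and
  `Hom_X(lim U_i, V) = colim Hom_X(U_i, V)` for `V` locally of finite presentation over `X`
  (EGA IV 8.13.1; in Mathlib as `Scheme.preservesColimit_yoneda`, for limit cones in `Over X` —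
  whence the choice of reading).
* Mathlib searches: `Adjunction.faithful_L_of_mono_unit_app`, `Adjunction.fullyFaithfulLOfIsIsoUnit`,
  `Sheaf.isLocallyBijective_iff_isIso`, `Presheaf.equalizerSieve_mem`,
  `Concrete.isColimit_rep_eq_iff_exists`, `Scheme.mem_toGrothendieck_smallPretopology`,
  `MorphismProperty.coverPreserving_comap_forget`; no statement about `Functor.sheafPullback`
  being faithful for a non-cocontinuous inclusion of sites exists. Nothing restated.
-/

universe u

open CategoryTheory Limits Opposite AlgebraicGeometry

noncomputable section

namespace Literature.AlgebraicGeometry.Motives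

/-! ### Covering sieves: pro-étale covers are surjective, surjective étale families cover -/

section CoveringSieves

variable {X : Scheme.{u}}

/-- **A pro-étale covering sieve is jointly surjective**: if `R` is a covering sieve of
`W ∈ X_proét`, every point of `W` is in the image of some `f : W' → W` in `R` (covers of `X_proét`
are fpqc covers, Bhatt–Scholze Def. 4.1.1; Mathlib: `ProEt.topology` is generated by the comap of
`proetalePrecoverage ≤ precoverage @WeaklyEtale`, whose covers are jointly surjective).
[cite: BhattScholze2015, Def. 4.1.1] -/
theorem exists_mem_of_mem_proEtTopology {W : X.ProEt} {R : Sieve W}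
    (hR : R ∈ Scheme.ProEt.topology X W) (w : W.left) :
    ∃ (W' : X.ProEt) (f : W' ⟶ W), R f ∧ w ∈ Set.range f.left := by
  have h₁ := (MorphismProperty.coverPreserving_comap_forget (S := X) Scheme.proetalePrecoverage
    Scheme.proetalePrecoverage_le_precoverage_weaklyEtale).cover_preserve hR
  rw [GrothendieckTopology.mem_over_iff] at h₁
  have h₂ : Sieve.overEquiv _ (R.functorPushforward (Scheme.ProEt.forget X)) ∈
      Scheme.grothendieckTopology @WeaklyEtale W.left :=
    Precoverage.toGrothendieck_mono (Scheme.propQCPrecoverage_le_precoverage (P := @WeaklyEtale))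
      _ h₁
  obtain ⟨𝒰, hle⟩ := Scheme.mem_grothendieckTopology_iff.1 h₂
  obtain ⟨i, y, rfl⟩ := 𝒰.exists_eq w
  obtain ⟨Z, g, h, hg, hfac⟩ := (Sieve.overEquiv_iff _ _).1 (hle _ _ (Presieve.ofArrows.mk i))
  refine ⟨Z, g, hg, h.left y, ?_⟩
  have := congrArg (fun k => k.left y) hfac
  simp only [Over.homMk_left] at this
  change ((h ≫ (Scheme.ProEt.forget X).map g).left y : W.left) = (𝒰.f i) y
  exact this.symm

/-- **A sieve of `X_ét` containing a jointly surjective family is a covering sieve** (covering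
sieves of the small étale site are generated by jointly surjective families of étale maps; Mathlib
`Scheme.mem_toGrothendieck_smallPretopology`). [folklore] -/
theorem mem_smallEtaleTopology_of_exists {U : X.Etale} (T : Sieve U)
    (h : ∀ x : U.left, ∃ (V : X.Etale) (g : V ⟶ U), T g ∧ x ∈ Set.range g.left) :
    T ∈ X.smallEtaleTopology U := by
  rw [Scheme.smallEtaleTopology,
    Scheme.smallGrothendieckTopology_eq_toGrothendieck_smallPretopology X le_rfl]
  refine (Scheme.mem_toGrothendieck_smallPretopology _ _).2 fun x => ?_
  obtain ⟨V, g, hg, y, hy⟩ := h x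
  exact ⟨V, g, y, hg, inferInstance, hy⟩

end CoveringSieves

/-! ### The constructed pullback `sheafify ∘ Lan` and its unit -/

section Construction

variable (X : Scheme.{u})

/-- Mathlib's *constructed* model of `ν*`: `F ↦ (Lan F)^#`, the sheafification of the left Kan
extension along `etaleToProet X` (`Functor.sheafPullbackConstruction.sheafPullback`); isomorphic
to `etaleToProetPullback X` (`etaleToProetPullbackIso`). [cite: BhattScholze2015, §5] -/
abbrev etaleToProetPullback' :
    Sheaf X.smallEtaleTopology Ab.{u + 1} ⥤ Sheaf (Scheme.ProEt.topology X) Ab.{u + 1} :=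
  Functor.sheafPullbackConstruction.sheafPullback (etaleToProet X) Ab.{u + 1}
    X.smallEtaleTopology (Scheme.ProEt.topology X)

/-- The adjunction `(Lan –)^# ⊣ ν_*` of the constructed model (Mathlib
`Functor.sheafPullbackConstruction.sheafAdjunctionContinuous`). [cite: BhattScholze2015, §5] -/
abbrev etaleToProetAdjunction' :
    etaleToProetPullback' X ⊣ proetToEtalePushforward X Ab.{u + 1} :=
  Functor.sheafPullbackConstruction.sheafAdjunctionContinuous (etaleToProet X) Ab.{u + 1}
    X.smallEtaleTopology (Scheme.ProEt.topology X)

/-- `ν* ≅ (Lan –)^#` (Mathlib `sheafPullbackIso`, uniqueness of left adjoints). [folklore] -/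
abbrev etaleToProetPullbackIso : etaleToProetPullback X ≅ etaleToProetPullback' X :=
  Functor.sheafPullbackConstruction.sheafPullbackIso (etaleToProet X) Ab.{u + 1}
    X.smallEtaleTopology (Scheme.ProEt.topology X)

/-- **The unit of `(Lan –)^# ⊣ ν_*` is `lanUnit` followed by `toSheafify`**: on underlying
presheaves, `η'_F = (F → ν^p Lan F) ≫ ν^p(Lan F → (Lan F)^#)` (unwinding Mathlib's
`Adjunction.restrictFullyFaithful` of the composite adjunction `Lan ⊣ ν^p`, `(-)^# ⊣ ι`). [folklore] -/
theorem etaleToProetAdjunction'_unit_app_hom (F : Sheaf X.smallEtaleTopology Ab.{u + 1}) :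
    ((etaleToProetAdjunction' X).unit.app F).hom =
      ((etaleToProet X).op.lanUnit.app F.obj) ≫
        (etaleToProet X).op.whiskerLeft
          (toSheafify (Scheme.ProEt.topology X) ((etaleToProet X).op.lan.obj F.obj)) := by
  have h := Adjunction.map_restrictFullyFaithful_unit_app
    (L := etaleToProetPullback' X) (R := proetToEtalePushforward X Ab.{u + 1})
    (((etaleToProet X).op.lanAdjunction Ab.{u + 1}).comp
      (sheafificationAdjunction (Scheme.ProEt.topology X) Ab.{u + 1}))
    (fullyFaithfulSheafToPresheaf X.smallEtaleTopology Ab.{u + 1}) (Functor.FullyFaithful.id _)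
    (Iso.refl _) (Iso.refl _) F
  simp only [Adjunction.comp_unit_app, Functor.lanAdjunction_unit, Iso.refl_hom, NatTrans.id_app,
    sheafificationAdjunction_unit_app] at h
  exact h

/-- The units of the abstract and the constructed adjunction differ by `ν_*` of the comparison
isomorphism: `η_F ≫ ν_*(e_F) = η'_F` (Mathlib `Adjunction.unit_leftAdjointUniq_hom_app`).
[folklore] -/
theorem etaleToProetAdjunction_unit_app (F : Sheaf X.smallEtaleTopology Ab.{u + 1}) :
    (etaleToProetAdjunction X).unit.app F ≫
        (proetToEtalePushforward X Ab.{u + 1}).map ((etaleToProetPullbackIso X).hom.app F) =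
      (etaleToProetAdjunction' X).unit.app F :=
  Adjunction.unit_leftAdjointUniq_hom_app _ _ F

end Construction

/-! ### `η_F(U)` is injective for every `U ∈ X_ét`; `ν*` is faithful -/

section Injective

variable (X : Scheme.{u})

/-- In a filtered colimit of abelian groups an element that dies in the colimit dies at some
stage — for index categories with objects in `Type (u+1)` and morphisms in `Type u` (the
categories of costructured arrows of `etaleToProet`) and values in `Ab.{u+1}`, by transport to the
equivalent small category `AsSmall K` (Mathlib `Concrete.isColimit_rep_eq_iff_exists`). [folklore] -/
theorem exists_map_eq_zero_of_isColimit {K : Type (u + 1)} [Category.{u} K] [IsFiltered K]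
    {D : K ⥤ Ab.{u + 1}} {c : Cocone D} (hc : IsColimit c) {j : K} (x : D.obj j)
    (hx : c.ι.app j x = 0) : ∃ (k : K) (α : j ⟶ k), D.map α x = 0 := by
  let e : AsSmall.{u + 1} K ≌ K := AsSmall.equiv.symm
  haveI : IsFiltered (AsSmall.{u + 1} K) := IsFiltered.of_equivalence e.symm
  let hc' : IsColimit (c.whisker e.functor) := hc.whiskerEquivalence e
  have h0 : (c.whisker e.functor).ι.app (AsSmall.up.obj j) x =
      (c.whisker e.functor).ι.app (AsSmall.up.obj j) 0 := by
    rw [map_zero]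
    exact hx
  obtain ⟨k, f, g, hfg⟩ :=
    (Concrete.isColimit_rep_eq_iff_exists (e.functor ⋙ D) hc' x 0).1 h0
  exact ⟨e.functor.obj k, e.functor.map f, hfg.trans (map_zero _)⟩

/-- Restriction along `f : W → U` of the image of `s ∈ F(U)` in `(Lan F)(U)` is the colimit
injection of `s` at the costructured arrow `(U, f)` of the pointwise colimit
`(Lan F)(W) = colim_{W → V} F(V)` (by `rfl`). [folklore] -/
theorem lan_map_lanUnit_app_apply (F : (X.Etale)ᵒᵖ ⥤ Ab.{u + 1}) {U : X.Etale} {W : X.ProEt}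
    (f : W ⟶ (etaleToProet X).obj U) (s : F.obj (op U)) :
    ((etaleToProet X).op.lan.obj F).map f.op (((etaleToProet X).op.lanUnit.app F).app (op U) s) =
      ((Functor.LeftExtension.mk _ ((etaleToProet X).op.leftKanExtensionUnit F)).coconeAt
        (op W)).ι.app (CostructuredArrow.mk f.op) s := by
  rfl

/-- **The kernel of `η'_F(U) : F(U) → (Lan F)^#(U)` is zero, for every `U ∈ X_ét`.** If `s ∈ F(U)`
maps to `0`, then (sheafification being locally injective) `s` restricts to `0` in `Lan F` on a
pro-étale covering sieve `R` of `U`; for `f : W → U` in `R`, `(Lan F)(W)` is the filtered colimit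
`colim_{W → V} F(V)`, so `s` already restricts to `0` in `F(V_f)` for some étale `g_f : V_f → U`
through which `f` factors; the `g_f` form a jointly surjective (`R` is, `exists_mem_of_mem_proEtTopology`)
family of étale maps, i.e. an étale covering sieve of `U` on which `s` vanishes, so `s = 0` since `F`
is separated. (The formal half of Bhatt–Scholze Lemma 5.1.2.) [cite: BhattScholze2015, Lemma 5.1.2] -/
theorem etaleToProetAdjunction'_unit_app_eq_zero (F : Sheaf X.smallEtaleTopology Ab.{u + 1})
    (U : X.Etale) (s : F.obj.obj (op U))
    (hs : ((etaleToProetAdjunction' X).unit.app F).hom.app (op U) s = 0) : s = 0 := by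
  have hs' : (toSheafify (Scheme.ProEt.topology X) ((etaleToProet X).op.lan.obj F.obj)).app
      (op ((etaleToProet X).obj U)) (((etaleToProet X).op.lanUnit.app F.obj).app (op U) s) = 0 := by
    rw [etaleToProetAdjunction'_unit_app_hom] at hs
    exact hs
  have hR := Presheaf.equalizerSieve_mem (Scheme.ProEt.topology X)
    (toSheafify (Scheme.ProEt.topology X) ((etaleToProet X).op.lan.obj F.obj))
    (((etaleToProet X).op.lanUnit.app F.obj).app (op U) s) 0 (hs'.trans (map_zero _).symm)
  -- the sieve of étale maps `g : V → U` with `s|_V = 0`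
  let T : Sieve U :=
    { arrows := fun V g => F.obj.map g.op s = 0
      downward_closed := by
        intro V V' g hg k
        rw [op_comp, F.obj.map_comp]
        change F.obj.map k.op (F.obj.map g.op s) = 0
        rw [hg, map_zero] }
  have hT : T ∈ X.smallEtaleTopology U := by
    refine mem_smallEtaleTopology_of_exists T fun x => ?_
    obtain ⟨W, f, hf, w, rfl⟩ := exists_mem_of_mem_proEtTopology hR x
    have h0 : ((Functor.LeftExtension.mk _
        ((etaleToProet X).op.leftKanExtensionUnit F.obj)).coconeAt (op W)).ι.app
          (CostructuredArrow.mk f.op) s = 0 :=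
      (lan_map_lanUnit_app_apply X F.obj f s).symm.trans (Eq.trans hf (map_zero _))
    obtain ⟨k, α, hα⟩ := exists_map_eq_zero_of_isColimit (j := CostructuredArrow.mk f.op)
      (Functor.isPointwiseLeftKanExtensionLeftKanExtensionUnit (etaleToProet X).op F.obj (op W))
      s h0
    have hw := CostructuredArrow.w α
    refine ⟨k.left.unop, α.left.unop, ?_, k.hom.unop.left w, ?_⟩
    · exact hα
    · exact congrArg (fun φ => φ.unop.left w) hw
  exact (Sheaf.isSeparated F) U T hT s 0 (fun V g hg => by rw [map_zero]; exact hg)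

/-- **`η'_F(U)` is injective for every `U ∈ X_ét`.** [cite: BhattScholze2015, Lemma 5.1.2] -/
theorem injective_etaleToProetAdjunction'_unit_app (F : Sheaf X.smallEtaleTopology Ab.{u + 1})
    (U : X.Etale) :
    Function.Injective (((etaleToProetAdjunction' X).unit.app F).hom.app (op U)) :=
  (injective_iff_map_eq_zero _).2 (etaleToProetAdjunction'_unit_app_eq_zero X F U)

/-- **`η_F(U) : F(U) → ν_*ν*F(U)` is injective for every abelian étale sheaf `F` and every
`U ∈ X_ét`** (for the unit of `etaleToProetAdjunction X`, transported along
`etaleToProetAdjunction_unit_app`). [cite: BhattScholze2015, Lemma 5.1.2] -/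
theorem injective_etaleToProetAdjunction_unit_app (F : Sheaf X.smallEtaleTopology Ab.{u + 1})
    (U : X.Etale) :
    Function.Injective (((etaleToProetAdjunction X).unit.app F).hom.app (op U)) := by
  have h := injective_etaleToProetAdjunction'_unit_app X F U
  rw [← etaleToProetAdjunction_unit_app] at h
  intro a b hab
  apply h
  exact congrArg (((proetToEtalePushforward X Ab.{u + 1}).map
    ((etaleToProetPullbackIso X).hom.app F)).hom.app (op U)) hab

/-- The unit `η'_F` of the constructed adjunction is a monomorphism. [cite: BhattScholze2015, Lemma 5.1.2] -/
instance mono_etaleToProetAdjunction'_unit_app (F : Sheaf X.smallEtaleTopology Ab.{u + 1}) :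
    Mono ((etaleToProetAdjunction' X).unit.app F) := by
  haveI : ∀ U, Mono (((etaleToProetAdjunction' X).unit.app F).hom.app U) := fun U =>
    ConcreteCategory.mono_of_injective _ (injective_etaleToProetAdjunction'_unit_app X F U.unop)
  haveI : Mono ((etaleToProetAdjunction' X).unit.app F).hom := NatTrans.mono_of_mono_app _
  exact Sheaf.Hom.mono_of_presheaf_mono _ _ _

/-- **The unit `η_F : F → ν_*ν*F` is a monomorphism** for every abelian étale sheaf `F`.
[cite: BhattScholze2015, Lemma 5.1.2] -/
instance mono_etaleToProetAdjunction_unit_app (F : Sheaf X.smallEtaleTopology Ab.{u + 1}) :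
    Mono ((etaleToProetAdjunction X).unit.app F) := by
  exact @mono_of_mono_fac _ _ _ _ _ _ _ _ (mono_etaleToProetAdjunction'_unit_app X F)
    (etaleToProetAdjunction_unit_app X F)

/-- `(Lan –)^#` is faithful (its unit is a monomorphism). [cite: BhattScholze2015, Lemma 5.1.2] -/
instance faithful_etaleToProetPullback' : (etaleToProetPullback' X).Faithful :=
  (etaleToProetAdjunction' X).faithful_L_of_mono_unit_app

/-- **`ν* : Shv(X_ét, Ab) → Shv(X_proét, Ab)` is faithful — proved** (the formal half of
Bhatt–Scholze Lemma 5.1.2, "the pullback `ν*` is fully faithful"; fullness needs Lemma 5.1.1, see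
`full_faithful_etaleToProetPullback_of_sections`). [cite: BhattScholze2015, Lemma 5.1.2] -/
instance faithful_etaleToProetPullback : (etaleToProetPullback X).Faithful :=
  Functor.Faithful.of_iso (etaleToProetPullbackIso X).symm

end Injective

/-! ### Fullness from surjectivity of the unit at affine objects -/

section Full

variable (X : Scheme.{u})

/-- If `η'_F(U)` is surjective for all affine `U ∈ X_ét`, then `η'_F` is an isomorphism: it is
injective everywhere (`injective_etaleToProetAdjunction'_unit_app`), hence locally bijective for the
étale topology (affine opens cover, `ofArrows_etOfOpensι_mem`), and a locally bijective morphism of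
sheaves is an isomorphism (Mathlib `Sheaf.isLocallyBijective_iff_isIso`). [folklore] -/
theorem isIso_etaleToProetAdjunction'_unit_app (F : Sheaf X.smallEtaleTopology Ab.{u + 1})
    (h : ∀ U : X.Etale, IsAffine U.left →
      Function.Surjective (((etaleToProetAdjunction' X).unit.app F).hom.app (op U))) :
    IsIso ((etaleToProetAdjunction' X).unit.app F) := by
  haveI : Sheaf.IsLocallyInjective ((etaleToProetAdjunction' X).unit.app F) :=
    Presheaf.isLocallyInjective_of_injective _ _
      (fun U => injective_etaleToProetAdjunction'_unit_app X F U.unop)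
  haveI : Sheaf.IsLocallySurjective ((etaleToProetAdjunction' X).unit.app F) := by
    constructor
    intro U x
    refine X.smallEtaleTopology.superset_covering ?_
      (ofArrows_etOfOpensι_mem U (fun V : U.left.affineOpens => V.1) fun y => ?_)
    · rw [Sieve.ofArrows, Sieve.generate_le_iff]
      rintro _ _ ⟨V⟩
      exact h (etOfOpens U V.1) V.2 _
    · obtain ⟨V, hV, hy, -⟩ := (TopologicalSpace.Opens.isBasis_iff_nbhd.1
        U.left.isBasis_affineOpens) (TopologicalSpace.Opens.mem_top y)
      exact ⟨⟨V, hV⟩, hy⟩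
  exact (Sheaf.isLocallyBijective_iff_isIso _).1 ⟨inferInstance, inferInstance⟩

/-- If `η'_F(U)` is surjective for all `F` and all affine `U`, then `ν*` is full (the unit of
`(Lan –)^# ⊣ ν_*` is an isomorphism, Mathlib `Adjunction.fullyFaithfulLOfIsIsoUnit`, transported
along `etaleToProetPullbackIso`). [folklore] -/
theorem full_etaleToProetPullback_of_surjective
    (h : ∀ (F : Sheaf X.smallEtaleTopology Ab.{u + 1}) (U : X.Etale), IsAffine U.left →
      Function.Surjective (((etaleToProetAdjunction' X).unit.app F).hom.app (op U))) :
    (etaleToProetPullback X).Full := by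
  haveI : ∀ F, IsIso ((etaleToProetAdjunction' X).unit.app F) := fun F =>
    isIso_etaleToProetAdjunction'_unit_app X F (h F)
  haveI : IsIso (etaleToProetAdjunction' X).unit := NatIso.isIso_of_isIso_app _
  haveI : (etaleToProetPullback' X).Full :=
    ((etaleToProetAdjunction' X).fullyFaithfulLOfIsIsoUnit).full
  exact Functor.Full.of_iso (etaleToProetPullbackIso X).symm

/-- Surjectivity of `η_F(U)` (abstract unit) implies surjectivity of `η'_F(U)` (constructed unit):
they differ by a component of the isomorphism `ν_*(e_F)` (`etaleToProetAdjunction_unit_app`).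
[folklore] -/
theorem surjective_unit'_of_surjective_unit (F : Sheaf X.smallEtaleTopology Ab.{u + 1})
    (U : X.Etale)
    (h : Function.Surjective (((etaleToProetAdjunction X).unit.app F).hom.app (op U))) :
    Function.Surjective (((etaleToProetAdjunction' X).unit.app F).hom.app (op U)) := by
  rw [← etaleToProetAdjunction_unit_app]
  intro y
  let e := (proetToEtalePushforward X Ab.{u + 1}).mapIso ((etaleToProetPullbackIso X).app F)
  obtain ⟨x, hx⟩ := h ((e.inv.hom.app (op U)) y)
  refine ⟨x, ?_⟩
  change (e.hom.hom.app (op U)) ((((etaleToProetAdjunction X).unit.app F).hom.app (op U)) x) = y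
  rw [hx, ← ConcreteCategory.comp_apply, ← NatTrans.comp_app]
  have : (e.inv ≫ e.hom).hom.app (op U) = 𝟙 _ := by rw [e.inv_hom_id]; rfl
  rw [show e.inv.hom ≫ e.hom.hom = (e.inv ≫ e.hom).hom from rfl, this]
  rfl

end Full

/-! ### Bhatt–Scholze Def. 4.2.1: presentations, and Lemma 5.1.1 as a named fact -/

section Presentation

variable (X : Scheme.{u})

/-- **Bhatt–Scholze Def. 4.2.1 — a presentation `W = lim_i U_i` of a pro-étale affine.** "An
object `U ∈ X_proét` is called a pro-étale affine if we can write `U = lim_i U_i` for a small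
cofiltered diagram `i ↦ U_i` of affine schemes in `X_ét`; the expression `U = lim_i U_i` is called a
presentation for `U`." Read on Mathlib's carriers: a small cofiltered category `ι`, a diagram
`ι ⥤ X.Etale` of affine schemes, and a cone in `X.ProEt` with apex `W` over the diagram
(transported along `etaleToProet X`) which is a limit cone of `X`-schemes, i.e. after
`ProEt.forget X : X.ProEt ⥤ Over X` ("All limits in question agree with those in `Sch/X`",
Lemma 4.1.8; it is then also a limit cone in `X.ProEt`, `ProetAffinePresentation.isLimitProEt`,
and Mathlib's form of EGA IV 8.13.1, `Scheme.preservesColimit_yoneda`, applies to it).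
[cite: BhattScholze2015, Def. 4.2.1 and Lemma 4.1.8] -/
structure ProetAffinePresentation (W : X.ProEt) where
  /-- the small cofiltered index category -/
  ι : Type u
  [smallCategory : SmallCategory ι]
  [isCofiltered : IsCofiltered ι]
  /-- the diagram `i ↦ U_i` of affine schemes in `X_ét` -/
  diagram : ι ⥤ X.Etale
  /-- each `U_i` is affine -/
  isAffine (i : ι) : IsAffine (diagram.obj i).left
  /-- the projections `W → U_i` -/
  π : (Functor.const ι).obj W ⟶ diagram ⋙ etaleToProet X
  /-- `W = lim_i U_i` as `X`-schemes -/
  isLimit : IsLimit ((Scheme.ProEt.forget X).mapCone (Cone.mk W π))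

/-- The index category of a presentation is a small category. [cite: BhattScholze2015, Def. 4.2.1] -/
instance ProetAffinePresentation.instSmallCategory {W : X.ProEt} (𝔭 : ProetAffinePresentation X W) :
    SmallCategory 𝔭.ι :=
  𝔭.smallCategory

/-- The index category of a presentation is cofiltered. [cite: BhattScholze2015, Def. 4.2.1] -/
instance ProetAffinePresentation.instIsCofiltered {W : X.ProEt}
    (𝔭 : ProetAffinePresentation X W) : IsCofiltered 𝔭.ι :=
  𝔭.isCofiltered

/-- A presentation is also a limit cone in `X_proét` (the fully faithful `ProEt.forget` reflects
limits; Bhatt–Scholze Lemma 4.1.8). [cite: BhattScholze2015, Lemma 4.1.8] -/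
def ProetAffinePresentation.isLimitProEt {W : X.ProEt} (𝔭 : ProetAffinePresentation X W) :
    IsLimit (Cone.mk W 𝔭.π) :=
  haveI : ReflectsLimitsOfSize.{u, u} (Scheme.ProEt.forget X) := fullyFaithful_reflectsLimits _
  isLimitOfReflects (Scheme.ProEt.forget X) 𝔭.isLimit

variable {X}

/-- **The canonical cocone `F(U_i) → ν*F(W)`** of a presentation `W = lim_i U_i`: the unit
`F(U_i) → ν_*ν*F(U_i) = ν*F(U_i)` followed by restriction along the projection `W → U_i`. Its
universality is the content of Bhatt–Scholze Lemma 5.1.1. [cite: BhattScholze2015, Lemma 5.1.1] -/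
def ProetAffinePresentation.sectionsCocone {W : X.ProEt} (𝔭 : ProetAffinePresentation X W)
    (F : Sheaf X.smallEtaleTopology Ab.{u + 1}) : Cocone (𝔭.diagram.op ⋙ F.obj) where
  pt := ((etaleToProetPullback X).obj F).obj.obj (op W)
  ι :=
    { app := fun i => ((etaleToProetAdjunction X).unit.app F).hom.app (op (𝔭.diagram.obj i.unop)) ≫
        ((etaleToProetPullback X).obj F).obj.map (𝔭.π.app i.unop).op
      naturality := fun i j a => by
        have hπ : 𝔭.π.app j.unop ≫ (etaleToProet X).map (𝔭.diagram.map a.unop) = 𝔭.π.app i.unop :=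
          (𝔭.π.naturality a.unop).symm.trans (Category.id_comp _)
        have hη := ((etaleToProetAdjunction X).unit.app F).hom.naturality (𝔭.diagram.map a.unop).op
        refine Eq.trans ?_ (Category.comp_id _).symm
        calc F.obj.map (𝔭.diagram.map a.unop).op ≫
              ((etaleToProetAdjunction X).unit.app F).hom.app (op (𝔭.diagram.obj j.unop)) ≫
                ((etaleToProetPullback X).obj F).obj.map (𝔭.π.app j.unop).op
            = (((etaleToProetAdjunction X).unit.app F).hom.app (op (𝔭.diagram.obj i.unop)) ≫
                ((etaleToProetPullback X).obj F).obj.map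
                  ((etaleToProet X).map (𝔭.diagram.map a.unop)).op) ≫
                ((etaleToProetPullback X).obj F).obj.map (𝔭.π.app j.unop).op :=
              (Category.assoc _ _ _).symm.trans (congrArg (· ≫ _) hη)
          _ = ((etaleToProetAdjunction X).unit.app F).hom.app (op (𝔭.diagram.obj i.unop)) ≫
                ((etaleToProetPullback X).obj F).obj.map
                  (𝔭.π.app j.unop ≫ (etaleToProet X).map (𝔭.diagram.map a.unop)).op :=
              (Category.assoc _ _ _).trans (congrArg
                (fun t => ((etaleToProetAdjunction X).unit.app F).hom.app
                  (op (𝔭.diagram.obj i.unop)) ≫ t)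
                (((etaleToProetPullback X).obj F).obj.map_comp _ _).symm)
          _ = _ := congrArg (fun t => ((etaleToProetAdjunction X).unit.app F).hom.app
                (op (𝔭.diagram.obj i.unop)) ≫ ((etaleToProetPullback X).obj F).obj.map t.op) hπ }

/-- The leg of `𝔭.sectionsCocone F` at `i` (by `rfl`). [folklore] -/
theorem ProetAffinePresentation.sectionsCocone_ι_app {W : X.ProEt}
    (𝔭 : ProetAffinePresentation X W) (F : Sheaf X.smallEtaleTopology Ab.{u + 1}) (i : 𝔭.ιᵒᵖ) :
    (𝔭.sectionsCocone F).ι.app i =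
      ((etaleToProetAdjunction X).unit.app F).hom.app (op (𝔭.diagram.obj i.unop)) ≫
        ((etaleToProetPullback X).obj F).obj.map (𝔭.π.app i.unop).op :=
  rfl

/-- **Bhatt–Scholze Lemma 5.1.1 — the sections of `ν*F` on a pro-étale affine** (named fact,
statement only). "For `F ∈ Shv(X_ét)` and `U ∈ X_proét^aff` with a presentation `U = lim_i U_i`,
one has `ν*F(U) = colim_i F(U_i)`." Read on Mathlib's carriers: for every presentation
`W = lim_i U_i` (`ProetAffinePresentation`, Def. 4.2.1) and every `Ab.{u+1}`-valued étale sheaf `F`,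
the canonical cocone `F(U_i) → ν*F(W)` (`ProetAffinePresentation.sectionsCocone`, with
`ν* = etaleToProetPullback X`) is a colimit cocone; the printed statement is for sheaves of sets on
the cut-off site `X_proét` (Remark 4.1.2), of which the abelian case is a consequence, and only the
existence of the `IsColimit` structure is recorded. Printed proof: reduce to `X = Spec A` affine,
where `X_proét` is equivalent to the site of ind-étale `A`-algebras with faithfully flat covers
(Thm. 2.3.4, Lemma 4.2.4), on which `B = colim B_i ↦ colim F(B_i)` is already a sheaf (Zariski
descent, étale descent for `F`, and exactness of filtered colimits). With the trivial presentation
of an affine `U ∈ X_ét` it yields `F ≃ ν_*ν*F` and the full faithfulness of `ν*` (Lemma 5.1.2,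
`full_faithful_etaleToProetPullback_of_sections`). [cite: BhattScholze2015, Lemma 5.1.1] -/
def nonempty_isColimit_sectionsCocone_etaleToProetPullback : Prop :=
  ∀ (X : Scheme.{u}) (W : X.ProEt) (𝔭 : ProetAffinePresentation X W)
    (F : Sheaf X.smallEtaleTopology Ab.{u + 1}), Nonempty (IsColimit (𝔭.sectionsCocone F))

variable (X)

/-- **The trivial presentation** of an affine `U ∈ X_ét`: the constant one-object diagram `U` with
the identity cone (Bhatt–Scholze: "we often implicitly assume that the indexing category has a
final object"; here it is the only object). [cite: BhattScholze2015, Def. 4.2.1] -/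
def ProetAffinePresentation.trivial (U : X.Etale) [IsAffine U.left] :
    ProetAffinePresentation X ((etaleToProet X).obj U) where
  ι := Discrete PUnit.{u + 1}
  diagram := (Functor.const _).obj U
  isAffine _ := inferInstanceAs (IsAffine U.left)
  π := { app := fun _ => 𝟙 _ }
  isLimit :=
    { lift := fun s => s.π.app ⟨⟨⟩⟩
      fac := fun s j => by
        obtain ⟨⟨⟩⟩ := j
        exact Category.comp_id _
      uniq := fun s m hm => (Category.comp_id m).symm.trans (hm ⟨⟨⟩⟩) }

/-- **Lemma 5.1.1 for the trivial presentation: `η_F(U)` is surjective for affine `U ∈ X_ét`.**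
The leg of the sections cocone of the trivial presentation at its unique index is `η_F(U)` itself,
and a colimit cocone over a category with a terminal object has an invertible leg there (Mathlib
`IsColimit.isIso_ι_app_of_isTerminal`). [cite: BhattScholze2015, Lemma 5.1.1 and Lemma 5.1.2] -/
theorem surjective_unit_of_sections (h : nonempty_isColimit_sectionsCocone_etaleToProetPullback.{u})
    (F : Sheaf X.smallEtaleTopology Ab.{u + 1}) (U : X.Etale) [IsAffine U.left] :
    Function.Surjective (((etaleToProetAdjunction X).unit.app F).hom.app (op U)) := by
  obtain ⟨hc⟩ := h X _ (ProetAffinePresentation.trivial X U) F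
  let j : (Discrete PUnit.{u + 1})ᵒᵖ := op ⟨⟨⟩⟩
  have hj : IsTerminal j := IsTerminal.ofUniqueHom (fun i => (Discrete.eqToHom rfl).op)
    fun i m => Subsingleton.elim _ _
  haveI := hc.isIso_ι_app_of_isTerminal j hj
  have he : ((ProetAffinePresentation.trivial X U).sectionsCocone F).ι.app j =
      ((etaleToProetAdjunction X).unit.app F).hom.app (op U) := by
    change ((etaleToProetAdjunction X).unit.app F).hom.app (op U) ≫
      ((etaleToProetPullback X).obj F).obj.map (𝟙 ((etaleToProet X).obj U)).op = _
    exact (congrArg (fun t => ((etaleToProetAdjunction X).unit.app F).hom.app (op U) ≫ t)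
      (((etaleToProetPullback X).obj F).obj.map_id _)).trans (Category.comp_id _)
  have hsurj : Function.Surjective
      (((ProetAffinePresentation.trivial X U).sectionsCocone F).ι.app j) := fun y =>
    ⟨inv (((ProetAffinePresentation.trivial X U).sectionsCocone F).ι.app j) y, by
      have := ConcreteCategory.congr_hom
        (IsIso.inv_hom_id (((ProetAffinePresentation.trivial X U).sectionsCocone F).ι.app j)) y
      simp only [ConcreteCategory.comp_apply, ConcreteCategory.id_apply] at this
      exact this⟩
  exact he ▸ hsurj

/-- **Bhatt–Scholze Lemma 5.1.2, first consequence of Lemma 5.1.1: `F ≃ ν_*ν*F`** — the unit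
`η_F` is an isomorphism for every abelian étale sheaf `F` ("Lemma 5.1.1 shows that `F ≃ ν_*ν*F` for
any `F ∈ Shv(X_ét)`"). Real proof: `η_F` is injective everywhere and surjective at affine objects
(`surjective_unit_of_sections`), hence locally bijective, hence an isomorphism of étale sheaves.
[cite: BhattScholze2015, Lemma 5.1.2] -/
theorem isIso_etaleToProetAdjunction_unit_app_of_sections
    (h : nonempty_isColimit_sectionsCocone_etaleToProetPullback.{u})
    (F : Sheaf X.smallEtaleTopology Ab.{u + 1}) :
    IsIso ((etaleToProetAdjunction X).unit.app F) := by
  haveI : IsIso ((etaleToProetAdjunction' X).unit.app F) :=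
    isIso_etaleToProetAdjunction'_unit_app X F fun U _ =>
      surjective_unit'_of_surjective_unit X F U (surjective_unit_of_sections X h F U)
  rw [← etaleToProetAdjunction_unit_app] at this
  exact @IsIso.of_isIso_comp_right _ _ _ _ _ _
    ((proetToEtalePushforward X Ab.{u + 1}).map ((etaleToProetPullbackIso X).hom.app F))
    (((proetToEtalePushforward X Ab.{u + 1}).mapIso ((etaleToProetPullbackIso X).app F)).isIso_hom)
    this

/-- **`ν*` is full, from Lemma 5.1.1.** [cite: BhattScholze2015, Lemma 5.1.2] -/
theorem full_etaleToProetPullback_of_sections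
    (h : nonempty_isColimit_sectionsCocone_etaleToProetPullback.{u}) :
    (etaleToProetPullback X).Full :=
  full_etaleToProetPullback_of_surjective X fun F U _ =>
    surjective_unit'_of_surjective_unit X F U (surjective_unit_of_sections X h F U)

end Presentation

/-! ### Lemma 5.1.2 from Lemma 5.1.1, and the trust base of the finiteness fact -/

/-- **Bhatt–Scholze Lemma 5.1.2 from Lemma 5.1.1, proved: `ν*` is fully faithful** — the named
fact `full_faithful_etaleToProetPullback` of `EtaleToProetExt.lean` follows from the sections
formula `nonempty_isColimit_sectionsCocone_etaleToProetPullback` (faithfulness being unconditional,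
`faithful_etaleToProetPullback`). [cite: BhattScholze2015, Lemma 5.1.2] -/
theorem full_faithful_etaleToProetPullback_of_sections
    (h : nonempty_isColimit_sectionsCocone_etaleToProetPullback.{u}) :
    full_faithful_etaleToProetPullback.{u} := fun X =>
  ⟨full_etaleToProetPullback_of_sections X h, inferInstance⟩

/-- Bhatt–Scholze Cor. 5.1.6 (`nonempty_addEquiv_sheafH_etaleToProetPullback`) from Lemma 5.1.1 and
the acyclicity of `ν*I` for injective `I`. [cite: BhattScholze2015, Cor. 5.1.6] -/
theorem nonempty_addEquiv_sheafH_etaleToProetPullback_of_sections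
    (h : nonempty_isColimit_sectionsCocone_etaleToProetPullback.{u})
    (hc : ∀ (X : Scheme.{u}) (I : Sheaf X.smallEtaleTopology Ab.{u}), Injective I →
      ∀ p : ℕ, Subsingleton (((etaleToProetPullbackULift X).obj I).H (p + 1))) :
    nonempty_addEquiv_sheafH_etaleToProetPullback.{u} :=
  nonempty_addEquiv_sheafH_etaleToProetPullback_of_facts
    (full_faithful_etaleToProetPullback_of_sections h) hc

/-- The bridge fact `nonempty_addEquiv_proetCohomology_etaleCohomology` from Lemma 5.1.1 and the
acyclicity of `ν*I`. [cite: BhattScholze2015, Cor. 5.1.6] -/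
theorem nonempty_addEquiv_proetCohomology_etaleCohomology_of_sections
    (h : nonempty_isColimit_sectionsCocone_etaleToProetPullback.{u})
    (hc : ∀ (X : Scheme.{u}) (I : Sheaf X.smallEtaleTopology Ab.{u}), Injective I →
      ∀ p : ℕ, Subsingleton (((etaleToProetPullbackULift X).obj I).H (p + 1))) :
    nonempty_addEquiv_proetCohomology_etaleCohomology.{u} :=
  nonempty_addEquiv_proetCohomology_etaleCohomology_of_etale_site_facts
    (full_faithful_etaleToProetPullback_of_sections h) hc

/-- **`finite_proetCohomology_zmod_of_isProper` from Milne VI Cor. 2.8, Bhatt–Scholze Lemma 5.1.1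
and the acyclicity of `ν*I`** — the current trust base of the pro-étale finiteness fact:
{`finite_etaleCohomology_of_isProper`, `nonempty_isColimit_sectionsCocone_etaleToProetPullback`,
the acyclicity hypothesis `hc` (proof of Cor. 5.1.6)}; the morphism of sites, exactness and
faithfulness of `ν*`, `ν* ∘ const = const`, the constant-sheaf identifications and the
dimension shifting are proved. [cite: Milne2025, VI Cor. 2.8] [cite: BhattScholze2015, Lemma 5.1.1
and Cor. 5.1.6] -/
theorem finite_proetCohomology_zmod_of_isProper_of_sections
    (h₂ : finite_etaleCohomology_of_isProper.{u})
    (h : nonempty_isColimit_sectionsCocone_etaleToProetPullback.{u})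
    (hc : ∀ (X : Scheme.{u}) (I : Sheaf X.smallEtaleTopology Ab.{u}), Injective I →
      ∀ p : ℕ, Subsingleton (((etaleToProetPullbackULift X).obj I).H (p + 1))) :
    finite_proetCohomology_zmod_of_isProper.{u} :=
  finite_proetCohomology_zmod_of_isProper_of_etale_site_facts h₂
    (full_faithful_etaleToProetPullback_of_sections h) hc

end Literature.AlgebraicGeometry.Motives

end
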